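import Summits.Ventures.CertifiedArithmetic.Expansions.DyadicValuation
import Mathlib.Tactic.Linarith
import Mathlib.Tactic.Positivity
import Mathlib.Tactic.Ring
import Mathlib.Tactic.NormNum

/-!
# COMPRESS, termination: the two FAST-TWO-SUM step lemmas in 2-adic valuations (new work)

New work of the certified-arithmetic venture (ENGINES group: shared numerical engines serving
client cells; rigour lives in the verifiers; every published number belongs to a client cell's
ledger, not to the engines group).  COMPRESS [Shewchuk1997, §2.7, Fig. 11] performs FAST-TWO-SUM
steps of two kinds; this file analyses both in terms of the 2-adic valuation `v = padicValRat 2`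
(`DyadicValuation.lean`), for ANY round-to-nearest `fl` with `p ≥ 2`:

* DOWN STEP `fastTwoSum_valuation_down` (Lines 3–4: carry `b` above, component `a` NONADJACENT
  below it, `Below 2 a b`): `v a + 2 ≤ v b`, the rounded sum `x` is nonzero, a vanishing roundoff
  means `v x = v a` (a MERGE), and a nonzero roundoff `y` has `v y = v a` while `x ≠ b` forces
  `v x < v b`.  (A full-odd `b` absorbs `a`; a `b` with a trailing zero leaves room:
  `|b + a| < 2^(k+p)`, so `ulp(b + a) ≤ ulp b` and `x − b = a − y ∈ 2^(v b)·ℤ` is too small to be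
  nonzero.)
* UP STEP `fastTwoSum_valuation_up` (Lines 11–12: component `g` WITH A TRAILING ZERO above,
  carry `Q` with `|Q| ≤ ulp g` below): `v Q ≤ k < v g` (`ulp g = 2^k`), `x ≠ 0`, `|x − g| ≤ 2^k`,
  a merge has `v x = v Q`, and an ACTIVE step (`y ≠ 0`, `x ≠ g`) has `v x ≤ k` and `v y ≤ v Q` —
  the nearest float to `g + Q` is `g`, `g ± 2^k` or (at a binade boundary) `g ∓ 2^(k−1)`, and the
  pinning lemma excludes every configuration with `v y > v Q`.

In both cases a step that changes anything STRICTLY LOWERS `v x + v y` below `v(carry) +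
v(component)` (or merges two nonzero numbers into one): this is the engine of the termination
proof (`CompressValuationDown.lean`, `CompressValuationUp.lean`, `CompressTerminates.lean`).

References: J. R. Shewchuk, Discrete Comput. Geom. 18 (1997) 305–363, Thm 6, §2.7 [Shewchuk1997];
S. Boldo, C.-P. Jeannerod, G. Melquiond, J.-M. Muller, Acta Numerica 32 (2023), §2.1, Algorithm 1
[BoldoEtAl2023].
-/

namespace Summit.Ventures.CertifiedArithmetic.Expansions

open Literature.ComputerArithmetic.JeannerodRump2018
open Literature.ComputerArithmetic.BoldoJeannerodMelquiondMuller2023 hiding twoSum twoSum_fst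
open Literature.ComputerArithmetic.Shewchuk1997

variable {p : ℕ} {emin : ℤ} {fl : ℚ → ℚ}

/-! ### The DOWN step -/

/-- **DOWN STEP IN VALUATIONS.** For nonzero floats `a`, `b` with `a` NONADJACENT BELOW `b`
(`Below 2 a b`) and `(x, y) = FAST-TWO-SUM(b, a)` under any round-to-nearest (`p ≥ 2`):
`v a + 2 ≤ v b`; `x ≠ 0`; `x + y = b + a`; `y = 0 ⟹ v x = v a`; `y ≠ 0 ⟹ v y = v a ∧ (x ≠ b ⟹
v x < v b)` (`v = padicValRat 2`). [cite: Shewchuk1997, Thm 6 p. 312; §2.7 Fig. 11 Lines 3–4] -/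
theorem fastTwoSum_valuation_down (hp : 2 ≤ p) (hfl : IsRoundNearest p emin fl) {a b : ℚ}
    (ha : IsFloat p emin a) (hb : IsFloat p emin b) (ha0 : a ≠ 0) (hb0 : b ≠ 0)
    (hab : Below 2 a b) :
    padicValRat 2 a + 2 ≤ padicValRat 2 b ∧ (fastTwoSum fl b a).1 ≠ 0 ∧
      (fastTwoSum fl b a).1 + (fastTwoSum fl b a).2 = b + a ∧
      ((fastTwoSum fl b a).2 = 0 → padicValRat 2 (fastTwoSum fl b a).1 = padicValRat 2 a) ∧
      ((fastTwoSum fl b a).2 ≠ 0 → padicValRat 2 (fastTwoSum fl b a).2 = padicValRat 2 a ∧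
        ((fastTwoSum fl b a).1 ≠ b → padicValRat 2 (fastTwoSum fl b a).1 < padicValRat 2 b)) := by
  have hp1 : 1 ≤ p := by omega
  have two0 : (2 : ℚ) ≠ 0 := by norm_num
  have mono : ∀ {m n : ℤ}, m ≤ n → (2 : ℚ) ^ m ≤ (2 : ℚ) ^ n :=
    fun h => zpow_le_zpow_right₀ (by norm_num) h
  obtain ⟨s, -, hsb, h2a⟩ := hab.normalize hb
  have hsβ : s ≤ padicValRat 2 b := le_padicValRat_two_of_onGrid hsb hb0
  have hαa := two_zpow_padicValRat_two_le_abs (OnGrid.of_isFloat ha) ha0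
  have hαβ : padicValRat 2 a + 2 ≤ padicValRat 2 b := by
    have h1 : (2 : ℚ) ^ (padicValRat 2 a + 1) < (2 : ℚ) ^ s := by
      rw [zpow_add_one₀ two0]; linarith
    have := (zpow_lt_zpow_iff_right₀ (by norm_num : (1 : ℚ) < 2)).mp h1
    omega
  have hsb' := hsb.two_zpow_le_abs hb0
  have hab2 : 2 * |a| < |b| := lt_of_lt_of_le h2a hsb'
  have hab_le : |a| ≤ |b| := by linarith [abs_nonneg a]
  have hex := fastTwoSum_exact hp1 hfl hb ha hab_le
  have hxF : IsFloat p emin (fl (b + a)) := (hfl _).1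
  rw [show fastTwoSum fl b a = (fl (b + a), b + a - fl (b + a)) from Prod.ext hex.1 hex.2.2.1]
  -- the exact sum `t = b + a`
  have ht0 : b + a ≠ 0 := by
    intro h; have : b = -a := by linarith
    rw [this, abs_neg] at hab2; linarith [abs_nonneg a]
  have hvt : padicValRat 2 (b + a) = padicValRat 2 a := by
    rw [add_comm]; exact padicValRat_two_add_eq_left ha0 hb0 (by omega)
  have hx0 : fl (b + a) ≠ 0 := by
    intro h0
    have hmin := (hfl (b + a)).2 b hb
    rw [h0, sub_zero, add_sub_cancel_left] at hmin
    have : |b| - |a| ≤ |b + a| := by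
      have := abs_sub_abs_le_abs_sub b (-a); rw [abs_neg, sub_neg_eq_add] at this; exact this
    linarith [abs_nonneg a]
  obtain ⟨k, hke, hk⟩ := exists_ulp_eq_two_zpow (p := p) (emin := emin) b
  have hkb : OnGrid k b := onGrid_of_two_zpow_le_ulp hb (by rw [hk])
  have hbβ : OnGrid (padicValRat 2 b) b := onGrid_padicValRat_two (OnGrid.of_isFloat hb) hb0
  by_cases heven : OnGrid (k + 1) b
  · -- `b` has a trailing zero
    have hk1β : k + 1 ≤ padicValRat 2 b := le_padicValRat_two_of_onGrid heven hb0
    have hbk : |b| < (2 : ℚ) ^ (k + p) := by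
      have := abs_lt_two_pow_mul_ulp (p := p) (emin := emin) b
      rw [hk] at this
      rwa [zpow_add₀ two0, zpow_natCast, mul_comm]
    have hβkp : padicValRat 2 b ≤ k + p := by
      have := (zpow_lt_zpow_iff_right₀ (by norm_num : (1 : ℚ) < 2)).mp
        ((two_zpow_padicValRat_two_le_abs (OnGrid.of_isFloat hb) hb0).trans_lt hbk)
      omega
    have hble : |b| ≤ (2 : ℚ) ^ (k + p) - (2 : ℚ) ^ (padicValRat 2 b) :=
      abs_le_two_zpow_sub_of_onGrid hbβ hβkp hbk
    have ha' : 2 * |a| < (2 : ℚ) ^ (padicValRat 2 b) := lt_of_lt_of_le h2a (mono hsβ)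
    have htk : |b + a| < (2 : ℚ) ^ (k + p) := by
      have h1 := abs_add_le b a
      have h2 : (0 : ℚ) ≤ |a| := abs_nonneg a
      linarith
    have hut : ulp p emin (b + a) ≤ (2 : ℚ) ^ k :=
      ulp_le_two_zpow_of_abs_lt hke (by rwa [add_comm (k : ℤ) p] at htk)
    obtain ⟨u, hue, hu⟩ := exists_ulp_eq_two_zpow (p := p) (emin := emin) (b + a)
    have huk : u ≤ k := by
      rw [hu] at hut; exact (zpow_le_zpow_iff_right₀ (by norm_num : (1 : ℚ) < 2)).mp hut
    obtain ⟨K, hK⟩ := exists_fl_eq_int_mul_ulp hp1 hfl (b + a)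
    have hxu : OnGrid u (fl (b + a)) := ⟨K, by rw [hK, hu]⟩
    have hyle : |b + a - fl (b + a)| ≤ (2 : ℚ) ^ (u - 1) := by
      have := abs_sub_fl_le_half_ulp hp1 hfl (b + a)
      rw [hu] at this
      have h2 : (2 : ℚ) ^ u / 2 = (2 : ℚ) ^ (u - 1) := by
        rw [zpow_sub_one₀ two0]; ring
      linarith
    refine ⟨hαβ, hx0, by ring, fun hy0 => ?_, fun hy0 => ?_⟩
    · have : fl (b + a) = b + a := by linarith
      rw [this, hvt]
    · -- `t` is not a float, so `v t < u ≤ v x`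
      have hαu : padicValRat 2 a < u := by
        by_contra hle; push Not at hle
        have htu : OnGrid u (b + a) := by
          have := onGrid_padicValRat_two ((OnGrid.of_isFloat hb).add (OnGrid.of_isFloat ha)) ht0
          rw [hvt] at this; exact this.mono hle
        obtain ⟨r, hr⟩ := htu
        have hrp : |r| < 2 ^ p := by
          have h1 := abs_lt_two_pow_mul_ulp (p := p) (emin := emin) (b + a)
          have h2u : (0 : ℚ) < (2 : ℚ) ^ u := zpow_pos (by norm_num) u
          rw [hu, hr, abs_mul, abs_of_pos h2u] at h1
          have h2 : |(r : ℚ)| < 2 ^ p := lt_of_mul_lt_mul_right h1 h2u.le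
          have : ((|r| : ℤ) : ℚ) < ((2 ^ p : ℤ) : ℚ) := by push_cast; exact h2
          exact_mod_cast this
        have htF : IsFloat p emin (b + a) := by rw [hr]; exact isFloat_of_int_mul r u hrp hue
        exact hy0 (by rw [fl_eq_self hfl htF, sub_self])
      have hux : u ≤ padicValRat 2 (fl (b + a)) := le_padicValRat_two_of_onGrid hxu hx0
      refine ⟨?_, fun hxb => ?_⟩
      · have h1 : b + a - fl (b + a) = (b + a) + -fl (b + a) := by ring
        rw [h1, padicValRat_two_add_eq_left ht0 (neg_ne_zero.mpr hx0)
          (by rw [padicValRat.neg, hvt]; omega), hvt]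
      · by_contra hge; push Not at hge
        have hd : OnGrid (padicValRat 2 b) (fl (b + a) - b) :=
          ((onGrid_padicValRat_two hxu hx0).mono hge).sub hbβ
        have hsmall : |fl (b + a) - b| < (2 : ℚ) ^ (padicValRat 2 b) := by
          have h1 : fl (b + a) - b = a - (b + a - fl (b + a)) := by ring
          rw [h1]
          have h2 := abs_sub (a) (b + a - fl (b + a))
          have h3 : (2 : ℚ) ^ (u - 1) ≤ (2 : ℚ) ^ (padicValRat 2 b - 2) := mono (by omega)
          have h4 : (2 : ℚ) ^ (padicValRat 2 b) = 2 * 2 * (2 : ℚ) ^ (padicValRat 2 b - 2) := by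
            rw [show padicValRat 2 b = (padicValRat 2 b - 2) + 2 by ring, zpow_add₀ two0]
            ring
          have h5 : (0 : ℚ) < (2 : ℚ) ^ (padicValRat 2 b - 2) := zpow_pos (by norm_num) _
          rw [h4] at ha' ⊢
          linarith
        exact hxb (sub_eq_zero.mp (eq_zero_of_onGrid_of_abs_lt_two_zpow hd hsmall))
  · -- `b` is full-odd: the step is inert
    have hβk : padicValRat 2 b ≤ k := by
      by_contra h; push Not at h
      exact heven (hbβ.mono (by omega))
    have hak : |a| < (2 : ℚ) ^ k / 2 := by
      have := mono (hsβ.trans hβk); linarith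
    have hinert := fastTwoSum_eq_of_fullOdd hp hfl hb hb0 ha hk heven hak
    have hx : fl (b + a) = b := by
      have := congrArg Prod.fst hinert; rw [hex.1] at this; exact this
    refine ⟨hαβ, hx0, by ring, fun hy0 => ?_,
      fun _ => ⟨by rw [hx, add_sub_cancel_left], fun hxb => ?_⟩⟩
    · rw [hx] at hy0; exact absurd (by linarith : a = 0) ha0
    · exact absurd hx hxb

/-! ### The UP step -/

/-- `g ± 2^k` are floats when `g` is a float with `ulp g = 2^k`.
[cite: BoldoEtAl2023, §2.1 Property 2.2] -/
theorem isFloat_add_ulp_signed (hp : 1 ≤ p) {g : ℚ} (hg : IsFloat p emin g) {k : ℤ}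
    (hk : ulp p emin g = (2 : ℚ) ^ k) (hek : emin ≤ k) :
    IsFloat p emin (g + (2 : ℚ) ^ k) ∧ IsFloat p emin (g - (2 : ℚ) ^ k) := by
  obtain ⟨M, hM⟩ := exists_eq_int_mul_ulp_of_isFloat (p := p) (emin := emin) hg
  have h2k : (0 : ℚ) < (2 : ℚ) ^ k := zpow_pos (by norm_num) k
  have hMp : |(M : ℚ)| < 2 ^ p := by
    have h1 := abs_lt_two_pow_mul_ulp (p := p) (emin := emin) g
    rw [hk] at hM h1
    rw [hM, abs_mul, abs_of_pos h2k] at h1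
    exact lt_of_mul_lt_mul_right h1 h2k.le
  have hMp' : |M| < 2 ^ p := by
    have : ((|M| : ℤ) : ℚ) < ((2 ^ p : ℤ) : ℚ) := by push_cast; exact hMp
    exact_mod_cast this
  rw [hk] at hM
  constructor
  · have h := isFloat_of_abs_le (emin := emin) hp (N := M + 1) (k := k)
      (by rw [abs_lt] at hMp'; rw [abs_le]; omega) hek
    rw [hM]; convert h using 1; push_cast; ring
  · have h := isFloat_of_abs_le (emin := emin) hp (N := M - 1) (k := k)
      (by rw [abs_lt] at hMp'; rw [abs_le]; omega) hek
    rw [hM]; convert h using 1; push_cast; ring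

/-- **UP STEP IN VALUATIONS.** For nonzero floats `g`, `Q` with `ulp g = 2^k`, `g ∈ 2^(k+1)·ℤ`
(a TRAILING ZERO) and `|Q| ≤ ulp g`, and `(x, y) = FAST-TWO-SUM(g, Q)` under any round-to-nearest
(`p ≥ 2`): `v Q ≤ k < v g`; `x ≠ 0`; `x + y = g + Q`; `|x − g| ≤ 2^k`; `y = 0 ⟹ v x = v Q`;
`y ≠ 0 ∧ x ≠ g ⟹ v x ≤ k ∧ v y ≤ v Q`. [cite: Shewchuk1997, Thm 6 p. 312; §2.7 Lines 11–12] -/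
theorem fastTwoSum_valuation_up (hp : 2 ≤ p) (hfl : IsRoundNearest p emin fl) {g Q : ℚ}
    (hg : IsFloat p emin g) (hQ : IsFloat p emin Q) (hg0 : g ≠ 0) (hQ0 : Q ≠ 0) {k : ℤ}
    (hk : ulp p emin g = (2 : ℚ) ^ k) (heven : OnGrid (k + 1) g) (hQg : |Q| ≤ ulp p emin g) :
    padicValRat 2 Q ≤ k ∧ k + 1 ≤ padicValRat 2 g ∧ (fastTwoSum fl g Q).1 ≠ 0 ∧
      (fastTwoSum fl g Q).1 + (fastTwoSum fl g Q).2 = g + Q ∧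
      |(fastTwoSum fl g Q).1 - g| ≤ (2 : ℚ) ^ k ∧
      ((fastTwoSum fl g Q).2 = 0 → padicValRat 2 (fastTwoSum fl g Q).1 = padicValRat 2 Q) ∧
      ((fastTwoSum fl g Q).2 ≠ 0 → (fastTwoSum fl g Q).1 ≠ g →
        padicValRat 2 (fastTwoSum fl g Q).1 ≤ k ∧
        padicValRat 2 (fastTwoSum fl g Q).2 ≤ padicValRat 2 Q) := by
  have hp1 : 1 ≤ p := by omega
  have two0 : (2 : ℚ) ≠ 0 := by norm_num
  have mono : ∀ {m n : ℤ}, m ≤ n → (2 : ℚ) ^ m ≤ (2 : ℚ) ^ n :=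
    fun h => zpow_le_zpow_right₀ (by norm_num) h
  have h2k : (0 : ℚ) < (2 : ℚ) ^ k := zpow_pos (by norm_num) k
  obtain ⟨k', hek, hk'⟩ := exists_ulp_eq_two_zpow (p := p) (emin := emin) g
  have hkk : k' = k := zpow_right_injective₀ (by norm_num : (0 : ℚ) < 2) (by norm_num)
    (hk'.symm.trans hk)
  subst hkk
  rw [hk'] at hQg
  have hvQ : padicValRat 2 Q ≤ k' := padicValRat_two_le_of_abs_le (OnGrid.of_isFloat hQ) hQ0 hQg
  have hvg : k' + 1 ≤ padicValRat 2 g := le_padicValRat_two_of_onGrid heven hg0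
  have hgabs : (2 : ℚ) ^ (k' + 1) ≤ |g| := heven.two_zpow_le_abs hg0
  rw [zpow_add_one₀ two0] at hgabs
  have hQg' : |Q| ≤ |g| := by linarith
  have hex := fastTwoSum_exact hp1 hfl hg hQ hQg'
  rw [show fastTwoSum fl g Q = (fl (g + Q), g + Q - fl (g + Q)) from Prod.ext hex.1 hex.2.2.1]
  have hxF : IsFloat p emin (fl (g + Q)) := (hfl _).1
  -- `|x - g| ≤ 2^k` by monotonicity against the floats `g ± 2^k`
  obtain ⟨hplus, hminus⟩ := isFloat_add_ulp_signed hp1 hg hk' hek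
  have hQ1 := (abs_le.mp hQg).1
  have hQ2 := (abs_le.mp hQg).2
  have hxle : fl (g + Q) ≤ g + (2 : ℚ) ^ k' := fl_le_of_le hfl hplus (by linarith)
  have hxge : g - (2 : ℚ) ^ k' ≤ fl (g + Q) := le_fl_of_le hfl hminus (by linarith)
  have hd : |fl (g + Q) - g| ≤ (2 : ℚ) ^ k' := abs_le.mpr ⟨by linarith, by linarith⟩
  have hx0 : fl (g + Q) ≠ 0 := by
    intro h0; rw [h0, zero_sub, abs_neg] at hd; linarith
  have ht0 : g + Q ≠ 0 := by
    intro h; have : g = -Q := by linarith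
    rw [this, abs_neg] at hgabs; linarith [abs_nonneg Q]
  have hvt : padicValRat 2 (g + Q) = padicValRat 2 Q := by
    rw [add_comm]; exact padicValRat_two_add_eq_left hQ0 hg0 (by omega)
  refine ⟨hvQ, hvg, hx0, by ring, hd, fun hy0 => ?_, fun hy0 hxg => ?_⟩
  · have : fl (g + Q) = g + Q := by linarith
    rw [this, hvt]
  · have hdx0 : fl (g + Q) - g ≠ 0 := sub_ne_zero.mpr hxg
    have hvx : padicValRat 2 (fl (g + Q)) ≤ k' := by
      by_contra h; push Not at h
      have hd1 : OnGrid (k' + 1) (fl (g + Q) - g) :=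
        ((onGrid_padicValRat_two (OnGrid.of_isFloat hxF) hx0).mono (by omega)).sub heven
      have : |fl (g + Q) - g| < (2 : ℚ) ^ (k' + 1) := by rw [zpow_add_one₀ two0]; linarith
      exact hdx0 (eq_zero_of_onGrid_of_abs_lt_two_zpow hd1 this)
    refine ⟨hvx, ?_⟩
    by_contra h; push Not at h
    have hyQd : g + Q - fl (g + Q) = Q - (fl (g + Q) - g) := by ring
    rw [hyQd] at h hy0
    have hvd : padicValRat 2 (fl (g + Q) - g) = padicValRat 2 Q :=
      padicValRat_two_eq_of_lt_sub hQ0 hdx0 h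
    -- `x ∈ 2^(k'-1)·ℤ`: in the normal range `|x| ≥ 2^(k'+p-2)`, else `k' = emin`
    have hxk1 : OnGrid (k' - 1) (fl (g + Q)) := by
      rcases hek.lt_or_eq with hlt | heq
      · have hglow := two_zpow_le_abs_of_ulp_eq hk' hlt
        have hsplit : (2 : ℚ) ^ (k' + p - 1) = 2 * (2 : ℚ) ^ (k' + p - 2) := by
          rw [show k' + (p : ℤ) - 1 = (k' + p - 2) + 1 by ring, zpow_add_one₀ two0]; ring
        have hkp : (2 : ℚ) ^ k' ≤ (2 : ℚ) ^ (k' + p - 2) := mono (by omega)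
        have hxabs : (2 : ℚ) ^ (k' + p - 2) ≤ |fl (g + Q)| := by
          have h1 : |g| - |fl (g + Q) - g| ≤ |fl (g + Q)| := by
            have := abs_sub_abs_le_abs_sub g (fl (g + Q))
            rw [abs_sub_comm g] at this; linarith
          linarith
        obtain ⟨K, hK⟩ := exists_eq_int_mul_two_zpow_of_isFloat hxF hxabs
        exact ⟨K, by rw [hK, show k' + (p : ℤ) - 2 - p + 1 = k' - 1 by ring]⟩
      · exact (OnGrid.of_isFloat hxF).mono (by omega)
    have hdk1 : OnGrid (k' - 1) (fl (g + Q) - g) := hxk1.sub (heven.mono (by omega))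
    have hm1 : k' - 1 ≤ padicValRat 2 Q := by
      rw [← hvd]; exact le_padicValRat_two_of_onGrid hdk1 hdx0
    have hkQ : (2 : ℚ) ^ k' ≤ (2 : ℚ) ^ (padicValRat 2 Q + 1) := mono (by omega)
    have hQabs : |Q| = (2 : ℚ) ^ (padicValRat 2 Q) :=
      abs_eq_two_zpow_of_odd_multiple (onGrid_padicValRat_two (OnGrid.of_isFloat hQ) hQ0)
        (not_onGrid_of_padicValRat_two_lt hQ0 (by omega)) (hQg.trans hkQ)
    have hdabs : |fl (g + Q) - g| = (2 : ℚ) ^ (padicValRat 2 Q) := by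
      refine abs_eq_two_zpow_of_odd_multiple ?_ ?_ (hd.trans hkQ)
      · rw [← hvd]; exact onGrid_padicValRat_two hdk1 hdx0
      · rw [← hvd]; exact not_onGrid_of_padicValRat_two_lt hdx0 (by omega)
    rcases abs_eq_abs.mp (hdabs.trans hQabs.symm) with h1 | h1
    · exact hy0 (by rw [h1, sub_self])
    · have hmin := (hfl (g + Q)).2 g hg
      have hx : fl (g + Q) = g - Q := by linarith
      rw [hx, add_sub_cancel_left, show g + Q - (g - Q) = 2 * Q by ring, abs_mul,
        abs_two] at hmin
      have : |Q| ≤ 0 := by linarith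
      exact hQ0 (abs_eq_zero.mp (le_antisymm this (abs_nonneg Q)))

end Summit.Ventures.CertifiedArithmetic.Expansions
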